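import Summits.BirchSwinnertonDyer.BirchSwinnertonDyer.Theorems.SylvesterTwoHeegnerIndexTwoAdicPairModelNonneg
import HarnessLib

/-!
# Route `SylvesterTwoHeegnerIndex` (rung K7t), item 19580 `TwoAdicPairHSY`: MEMO THEOREM C as a
# fact-free NAMED statement (planner D107 §2, for the crux item `HSYPointTwoDivisibleSevenModNine`)

Cell `bsd-cm`, seat `bsd-cm-two` (prover-bsd-cm-two-g5-0). PARTITION (D55): CornerF at `p = 2`
(B14/O12) × 𝒞_HSY ∩ {p ≡ 7 (mod 9)} × `p = 2` — types-the-object-of; closes no cell and no item;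
BSD is not claimed. Route-posited statements (D-0014: problem side), NO named fact inside, nothing
asserted: two `def … : Prop` and one proved bridge.

* `HSYPointTwoDivisibleSevenModNine` — MEMO bsd-cm-two v2.6 §15.5 **THEOREM C** («for every prime
  `p ≡ 7 (mod 9)` Hu–Shu–Yin's Heegner point `Y ∈ E_p(K)`, `K = ℚ(√−3)`, lies in `2·E_p(K) + E_p(K)_tors`,
  i.e. `m(p) ≥ 1`»; proof in the memo by Shimura reciprocity for the CM point on `X_0(3⁵)`; refereed in
  the cell (REF-13), NOT in print, NOT kernel), typed FACT-FREE in the currency of x1b GEN 48's cited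
  display `HuShuYin2019.shaAnPair_mul_height_eq_two_zpow_mul_height` / `…TwoAdicPairEngine`: since that
  fact supplies Hu–Shu–Yin's `Y` only existentially, the statement quantifies over EVERY point `Y` of a
  model `B ≅ E_p` over a quadratic `K ∋ ω` standing in Hu–Shu–Yin's display
  `(#Ш_an(B)·#Ш_an(A))·ĥ_K(ι P₀) = 2^{−2}·ĥ_K(Y)` against the generator `P₀` — all such `Y` have the same
  height, hence (the `K`-line being `ℤ₂[ω]`-integral along `P₀`, `…GeneratorNotHalvable`) the same
  `2`-divisibility, so this IS Theorem C, neither weaker nor stronger given the display.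
* `PairProductTwoIntegralSevenModNine` — the same content read through the display: for `p ≡ 7 (9)`
  the product `#Ш_an(E_p)·#Ш_an(E_{3p²})` is a `2`-ADIC INTEGER (`0 ≤ ord₂`); verbatim the hypothesis
  of x1b's glue `twoAdicPairHSY_of_fact_of_thmC` and of `twoAdicPairHSY_of_bsdDisplay_of_twoIntegral`.
* `exists_nat_padicValRat_two_eq_of_model_of_thmC` (PROVED): Theorem C (first form) gives, for every
  engine datum at a prime `p ≡ 7 (9)` (`K, ω, B, C, P₀, Y, qB, qA` with the display, `rank_ℤ B(K) = 2`),
  `ord₂(qB·qA) = 2m` with `m ∈ ℕ` — one application of `exists_nat_padicValRat_two_eq_of_model_of_twoDivisible`.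
  So `TwoAdicPairHSY` on `p ≡ 7 (9)` = [Hu–Shu–Yin's display (PRINT)] + [this def]; on `p ≡ 4 (9)` =
  the display alone (`exists_nat_padicValRat_two_eq_of_model`).

## References
* MEMO bsd-cm-two v2.6 (HOME/frozen/MEMO-bsd-cm-two.v2.6.58efc9f6d4c526f2.md) §15.5 Theorem C, §16 (m ≥ 1 on
  65/65 surveyed p ≡ 7 (9)); planner memo HOME/bsd-cm-plan/g17/K7t/CLOSURE-PATH-19580.md §2.
* Y. Hu, J. Shu, H. Yin, Trans. AMS 372 (2019) = arXiv:1708.05266, p. 12 display (bsd) (`i = −2` for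
  `p ≡ 7 (9)`); H. Yin, arXiv:2607.01744 p. 12 (the `2`-divisibility stated there only as a BSD
  PREDICTION: «[√−3]φ(τ_r) is usually the generator or twice the generator»).
-/

set_option autoImplicit false
-- the Summit-side namespace `Summit.BirchSwinnertonDyer.BirchSwinnertonDyer.…` (summit = problem) is mandated by D-0017
set_option linter.dupNamespace false

noncomputable section

open scoped Classical

open WeierstrassCurve WeierstrassCurve.Affine WeierstrassCurve.Affine.Point
  Literature.NumberTheory.EllipticCurves Literature.NumberTheory.EllipticCurves.HuShuYin2019

namespace Summit.BirchSwinnertonDyer.BirchSwinnertonDyer.Theorems.SylvesterTwoNonneg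

/-- **MEMO THEOREM C as a fact-free statement** (cell theorem, refereed, NOT in print, NOT kernel —
to be carried as the crux item `HSYPointTwoDivisibleSevenModNine` of route K7t): for every prime
`p ≡ 7 (mod 9)` with `3 ∉ 𝔽_p^{×3}`, all minimal models `B ≅ E_p`, `A ≅ E_{3p²}`, every quadratic
number field `K ∋ ω` (`ω² + ω + 1 = 0`), every rational point `P₀` of `B` with `ι P₀` of infinite
order generating `ι B(ℚ)` modulo torsion, and every `Y ∈ B(K)` standing in Hu–Shu–Yin's display
`(#Ш_an(B)·#Ш_an(A))·ĥ_K(ι P₀) = 2^{−2}·ĥ_K(Y)`: **`Y ∈ 2·B(K) + B(K)_tors`**. [cite: HuShuYin2019, p. 12 display (bsd), i = −2] -/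
@[conjecture] def HSYPointTwoDivisibleSevenModNine : Prop :=
  ∀ (p : ℕ), p.Prime → p % 9 = 7 → (¬ ∃ x : ZMod p, x ^ 3 = 3) →
    ∀ (A B : WeierstrassCurve ℚ) [A.IsElliptic] [A.IsGloballyMinimal] [B.IsElliptic]
      [B.IsGloballyMinimal],
      (∃ C : VariableChange ℚ, C • B = cubeSumCurve (p : ℚ)) →
      (∃ C : VariableChange ℚ, C • A = cubeSumCurve (3 * (p : ℚ) ^ 2)) →
      ∀ (qB qA : ℚ), shaAn B = (qB : ℂ) → shaAn A = (qA : ℂ) →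
      ∀ (K : Type) [Field K] [NumberField K] (ω : K), ω ^ 2 + ω + 1 = 0 →
        Module.finrank ℚ K = 2 →
        ∀ (P₀ : B.toAffine.Point), ¬ IsOfFinAddOrder (QuadraticDescent.incl K B P₀) →
          (∀ Q : B.toAffine.Point, ∃ m : ℤ,
            IsOfFinAddOrder (QuadraticDescent.incl K B Q - m • QuadraticDescent.incl K B P₀)) →
          ∀ (Y : (B.baseChange K).toAffine.Point),
            ((qB * qA : ℚ) : ℝ) * canonicalHeight (QuadraticDescent.incl K B P₀) =
              (2 : ℝ) ^ (-2 : ℤ) * canonicalHeight Y →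
            ∃ Y' T' : (B.baseChange K).toAffine.Point, IsOfFinAddOrder T' ∧ Y = (2 : ℤ) • Y' + T'

/-- **The `2`-INTEGRALITY of the pair product on `p ≡ 7 (mod 9)`** (Theorem C read through
Hu–Shu–Yin's display): for every prime `p ≡ 7 (mod 9)` with `3 ∉ 𝔽_p^{×3}` and all minimal models
`B ≅ E_p`, `A ≅ E_{3p²}`, `0 ≤ ord₂(#Ш_an(B)·#Ш_an(A))`. Verbatim the `p ≡ 7` hypothesis of the glue
theorems `SylvesterTwoPairParity.twoAdicPairHSY_of_bsdDisplay_of_twoIntegral` (restricted) and x1b's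
`twoAdicPairHSY_of_fact_of_thmC`. [cite: HuShuYin2019, p. 12 display (bsd), i = −2] -/
@[conjecture] def PairProductTwoIntegralSevenModNine : Prop :=
  ∀ (p : ℕ), p.Prime → p % 9 = 7 → (¬ ∃ x : ZMod p, x ^ 3 = 3) →
    ∀ (A B : WeierstrassCurve ℚ) [A.IsElliptic] [A.IsGloballyMinimal] [B.IsElliptic]
      [B.IsGloballyMinimal],
      (∃ C : VariableChange ℚ, C • B = cubeSumCurve (p : ℚ)) →
      (∃ C : VariableChange ℚ, C • A = cubeSumCurve (3 * (p : ℚ) ^ 2)) →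
      ∀ qB qA : ℚ, shaAn B = (qB : ℂ) → shaAn A = (qA : ℂ) → 0 ≤ padicValRat 2 (qB * qA)

/-- **Theorem C ⇒ `ord₂(#Ш_an(E_p)·#Ш_an(E_{3p²})) = 2m`, `m ∈ ℕ`, at every engine datum of a prime
`p ≡ 7 (mod 9)`** (`K ∋ ω` quadratic, `B`, `A` minimal models, `P₀` generator, `rank_ℤ B(K) = 2`, `Y`
with the display, `qB·qA ≠ 0`): one application of
`exists_nat_padicValRat_two_eq_of_model_of_twoDivisible` (parity by x1b's engine, non-negativity by
this seat's descent). [cite: HuShuYin2019, pp. 8, 12] -/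
theorem exists_nat_padicValRat_two_eq_of_model_of_thmC (hC : HSYPointTwoDivisibleSevenModNine)
    {K : Type} [Field K] [NumberField K] {ω : K} (hω : ω ^ 2 + ω + 1 = 0)
    (h2K : Module.finrank ℚ K = 2) {p : ℕ} (hp : p.Prime) (h7 : p % 9 = 7)
    (h3 : ¬ ∃ x : ZMod p, x ^ 3 = 3) (A B : WeierstrassCurve ℚ) [A.IsElliptic] [A.IsGloballyMinimal]
    [B.IsElliptic] [B.IsGloballyMinimal] (C : VariableChange ℚ) (hCB : C • B = cubeSumCurve (p : ℚ))
    (hA : ∃ C : VariableChange ℚ, C • A = cubeSumCurve (3 * (p : ℚ) ^ 2))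
    (hrank : (B.baseChange K).mordellWeilRank = 2) (P₀ : B.toAffine.Point)
    (hP : ¬ IsOfFinAddOrder (QuadraticDescent.incl K B P₀))
    (hgen : ∀ Q : B.toAffine.Point, ∃ m : ℤ,
      IsOfFinAddOrder (QuadraticDescent.incl K B Q - m • QuadraticDescent.incl K B P₀))
    (Y : (B.baseChange K).toAffine.Point) {qB qA : ℚ} (hqB : shaAn B = (qB : ℂ))
    (hqA : shaAn A = (qA : ℂ)) (hq : qB * qA ≠ 0)
    (hid : ((qB * qA : ℚ) : ℝ) * canonicalHeight (QuadraticDescent.incl K B P₀) =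
      (2 : ℝ) ^ (-2 : ℤ) * canonicalHeight Y) :
    ∃ m : ℕ, padicValRat 2 (qB * qA) = 2 * m := by
  have hp2 : p ≠ 2 := by rintro rfl; norm_num at h7
  exact exists_nat_padicValRat_two_eq_of_model_of_twoDivisible hω h2K hp hp2 B C hCB hrank P₀ hP hgen
    Y hq hid (hC p hp h7 h3 A B ⟨C, hCB⟩ hA qB qA hqB hqA K ω hω h2K P₀ hP hgen Y hid)

end Summit.BirchSwinnertonDyer.BirchSwinnertonDyer.Theorems.SylvesterTwoNonneg

end
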